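import Mathlib.Analysis.InnerProductSpace.PiL2
import Mathlib.Analysis.InnerProductSpace.Calculus
import Mathlib.Analysis.Calculus.ContDiff.Basic
import Mathlib.Analysis.Calculus.ContDiff.Deriv
import Mathlib.Analysis.Calculus.FDeriv.Mul
import Mathlib.Analysis.Calculus.FDeriv.Prod
import Mathlib.Analysis.Calculus.FDeriv.WithLp
import Mathlib.Analysis.Calculus.ContDiff.WithLp
import Mathlib.Analysis.Calculus.Deriv.Shift
import Mathlib.Analysis.Calculus.InverseFunctionTheorem.FDeriv
import Mathlib.Analysis.Normed.Operator.BoundedLinearMaps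
import Mathlib.Analysis.Normed.Module.Ball.Homeomorph
import Mathlib.Topology.Algebra.Module.FiniteDimension
import Mathlib.LinearAlgebra.FiniteDimensional.Lemmas
import Mathlib.Analysis.Calculus.ContDiff.RCLike
import Mathlib.Topology.Compactness.Compact
import Literature.Topology.FourManifolds.TorusCoordinates
import HarnessLib

/-!
# Tubes around framed closed curves on `S³`

The local analysis of the **radial tube map** of a framed regular closed curve on the unit sphere
`S³ ⊆ ℝ⁴`, the elementary substitute for the exponential map of the normal bundle used by
`KnotTubeProofs.lean` to construct a topological tubular neighbourhood `S¹ × ℝ² ↪ S³` of every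
smooth knot (framings come from `KnotFraming.lean`), and thereby to discharge the named facts
`Literature.Topology.FourManifolds.Knot.fg_group` and `Literature.Topology.FourManifolds.Knot.IsAlexanderPolynomial.isUnit_eval_one`. Everything here is
proved; this file holds the definitions and the inverse-function-theorem step, the sibling proof
file the global injectivity and the descent to `S¹ × ℝ²`.

## Contents

* `Literature.tubeFun k n₁ n₂ (t, u) = k t + u₀ n₁ t + u₁ n₂ t ∈ ℝ⁴` (affine tube map),
  `Literature.tubeConeMap k n₁ n₂ ((t, u), s) = s • tubeFun (t, u)` (its cone, a self-map of a
  `4`-dimensional space), `Literature.tubeProj = tubeFun / ‖tubeFun‖` (radial tube map, values on `S³`).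
* `Literature.IsFramedCurve k n₁ n₂`: `k` is a `C^∞` `1`-periodic regular closed curve on the unit sphere
  and `n₁, n₂` a `C^∞` periodic normal framing (`k, k', n₁, n₂` pairwise orthogonal, nonzero).
* `Literature.Topology.FourManifolds.IsFramedCurve.exists_hasFDerivAt_equiv`: along the core circle the cone map has invertible
  derivative `((τ, w), σ) ↦ τ k' + w₀ n₁ + w₁ n₂ + σ k`.
* `Literature.Topology.FourManifolds.tubeGood`: the open (`isOpen_tubeGood`), `ℤ`-periodic set of parameters where `tubeFun ≠ 0`
  and the cone map has invertible derivative at height `‖tubeFun‖⁻¹`; it contains the core circle,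
  hence a uniform slab `ℝ × B(0, ε)` (`exists_ball_subset_tubeGood`, tube lemma + periodicity).
* At good parameters the radial tube map is **open into the sphere**
  (`exists_nhds_inter_sphere_subset_image`) and **locally injective** (`exists_injOn_tubeProj`):
  the inverse function theorem (`HasStrictFDerivAt.map_nhds_eq_of_equiv`,
  `HasStrictFDerivAt.toOpenPartialHomeomorph`) for the cone map, whose restriction to height
  `‖tubeFun‖⁻¹` is `tubeProj` and which maps `{height > 0}` onto rays.
* `Literature.IsTubeRadius k n₁ n₂ ε`: `ε > 0`, the slab `ℝ × B(0, ε)` is good, and on it `tubeProj`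
  identifies exactly the `ℤ`-translates in the curve parameter (proved to exist for embedded
  curves in `KnotTubeProofs.lean`).
* `Literature.tubeMap k n₁ n₂ ε : S¹ × ℝ² → ℝ⁴`, `(z, u) ↦ tubeProj (angA z, univBall 0 ε u)`: the radial
  tube map descended to the circle (`angA` a set-theoretic section of `circlePt`,
  `TorusCoordinates.lean`) and spread over the whole plane (`OpenPartialHomeomorph.univBall`).

## Sources

Standard differential topology (tubular neighbourhoods: M. W. Hirsch, *Differential Topology*
(1976), §4.5); all statements are elementary and tagged `[folklore]`. No named facts are
introduced.
-/

open scoped Topology Real RealInnerProductSpace ContDiff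
open Set Function Metric Filter

noncomputable section

namespace Literature.Topology.FourManifolds


/-- Local notation: `𝔼 n` is the model Euclidean space `EuclideanSpace ℝ (Fin n)`. -/
local notation "𝔼 " n:arg => EuclideanSpace ℝ (Fin n)

section Tube

variable (k n₁ n₂ : ℝ → 𝔼 4)

/-- The **affine tube map** of a framed curve: `(t, u) ↦ k(t) + u₀ n₁(t) + u₁ n₂(t) ∈ ℝ⁴`.
[folklore] -/
def tubeFun (q : ℝ × 𝔼 2) : 𝔼 4 := k q.1 + q.2 0 • n₁ q.1 + q.2 1 • n₂ q.1

/-- The **cone** over the affine tube map: `((t, u), s) ↦ s · (k(t) + u₀ n₁(t) + u₁ n₂(t))`; for a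
framed curve on `S³` it is a local diffeomorphism of `ℝ⁴` near `s = 1`, `u = 0`. [folklore] -/
def tubeConeMap (x : (ℝ × 𝔼 2) × ℝ) : 𝔼 4 := x.2 • tubeFun k n₁ n₂ x.1

/-- The **radial tube map** `(t, u) ↦ (k + u₀ n₁ + u₁ n₂)/‖k + u₀ n₁ + u₁ n₂‖`, with values on
the unit sphere wherever the affine tube map does not vanish (junk value `0` where it vanishes,
by the convention `0⁻¹ = 0`; such parameters are never used: they lie outside `tubeGood`).
[folklore] -/
def tubeProj (q : ℝ × 𝔼 2) : 𝔼 4 := ‖tubeFun k n₁ n₂ q‖⁻¹ • tubeFun k n₁ n₂ q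

variable {k n₁ n₂}

/-- Unfolding of the affine tube map. [folklore] -/
theorem tubeFun_apply (q : ℝ × 𝔼 2) :
    tubeFun k n₁ n₂ q = k q.1 + q.2 0 • n₁ q.1 + q.2 1 • n₂ q.1 := rfl

/-- On the zero section the affine tube map is the curve. [folklore] -/
@[simp] theorem tubeFun_zero (t : ℝ) : tubeFun k n₁ n₂ (t, 0) = k t := by
  simp [tubeFun]

/-- Unfolding of the cone map. [folklore] -/
theorem tubeConeMap_apply (x : (ℝ × 𝔼 2) × ℝ) :
    tubeConeMap k n₁ n₂ x = x.2 • tubeFun k n₁ n₂ x.1 := rfl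

/-- Unfolding of the radial tube map. [folklore] -/
theorem tubeProj_apply (q : ℝ × 𝔼 2) :
    tubeProj k n₁ n₂ q = ‖tubeFun k n₁ n₂ q‖⁻¹ • tubeFun k n₁ n₂ q := rfl

/-- Where the affine tube map does not vanish, the radial tube map takes values on the unit sphere.
[folklore] -/
theorem norm_tubeProj {q : ℝ × 𝔼 2} (hq : tubeFun k n₁ n₂ q ≠ 0) : ‖tubeProj k n₁ n₂ q‖ = 1 := by
  rw [tubeProj_apply, norm_smul, norm_inv, norm_norm, inv_mul_cancel₀ (norm_ne_zero_iff.2 hq)]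

/-- The radial tube map is the cone map at height `‖tubeFun‖⁻¹`. [folklore] -/
theorem tubeConeMap_inv_norm {q : ℝ × 𝔼 2} :
    tubeConeMap k n₁ n₂ (q, ‖tubeFun k n₁ n₂ q‖⁻¹) = tubeProj k n₁ n₂ q := rfl

/-! #### Smoothness -/

/-- The affine tube map of `C^∞` data is `C^∞`. [folklore] -/
theorem contDiff_tubeFun (hk : ContDiff ℝ ∞ k) (hn₁ : ContDiff ℝ ∞ n₁) (hn₂ : ContDiff ℝ ∞ n₂) :
    ContDiff ℝ ∞ (tubeFun k n₁ n₂) := by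
  unfold tubeFun
  have h0 : ContDiff ℝ ∞ fun q : ℝ × 𝔼 2 => q.2 0 :=
    (contDiff_piLp_apply (p := 2) (i := (0 : Fin 2))).comp contDiff_snd
  have h1 : ContDiff ℝ ∞ fun q : ℝ × 𝔼 2 => q.2 1 :=
    (contDiff_piLp_apply (p := 2) (i := (1 : Fin 2))).comp contDiff_snd
  exact ((hk.comp contDiff_fst).add (h0.smul (hn₁.comp contDiff_fst))).add
    (h1.smul (hn₂.comp contDiff_fst))

/-- The cone map of `C^∞` data is `C^∞`. [folklore] -/
theorem contDiff_tubeConeMap (hk : ContDiff ℝ ∞ k) (hn₁ : ContDiff ℝ ∞ n₁) (hn₂ : ContDiff ℝ ∞ n₂) :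
    ContDiff ℝ ∞ (tubeConeMap k n₁ n₂) :=
  contDiff_snd.smul ((contDiff_tubeFun hk hn₁ hn₂).comp contDiff_fst)

/-- The affine tube map of `C^∞` data is continuous. [folklore] -/
theorem continuous_tubeFun (hk : ContDiff ℝ ∞ k) (hn₁ : ContDiff ℝ ∞ n₁) (hn₂ : ContDiff ℝ ∞ n₂) :
    Continuous (tubeFun k n₁ n₂) :=
  (contDiff_tubeFun hk hn₁ hn₂).continuous

/-- The radial tube map is continuous wherever the affine tube map does not vanish. [folklore] -/
theorem continuousAt_tubeProj (hk : ContDiff ℝ ∞ k) (hn₁ : ContDiff ℝ ∞ n₁)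
    (hn₂ : ContDiff ℝ ∞ n₂) {q : ℝ × 𝔼 2} (hq : tubeFun k n₁ n₂ q ≠ 0) :
    ContinuousAt (tubeProj k n₁ n₂) q := by
  have hc := (continuous_tubeFun hk hn₁ hn₂).continuousAt (x := q)
  exact ((hc.norm.inv₀ (norm_ne_zero_iff.2 hq)).smul hc)

/-! #### The derivative of the cone map -/

/-- The derivative of the cone map, in closed form. [folklore] -/
theorem hasFDerivAt_tubeConeMap (hk : ContDiff ℝ ∞ k) (hn₁ : ContDiff ℝ ∞ n₁)
    (hn₂ : ContDiff ℝ ∞ n₂) (x : (ℝ × 𝔼 2) × ℝ) :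
    ∃ L : ((ℝ × 𝔼 2) × ℝ) →L[ℝ] 𝔼 4, HasFDerivAt (tubeConeMap k n₁ n₂) L x ∧
      ∀ v, L v = x.2 • (v.1.1 • deriv k x.1.1
        + (v.1.2 0 • n₁ x.1.1 + x.1.2 0 • v.1.1 • deriv n₁ x.1.1)
        + (v.1.2 1 • n₂ x.1.1 + x.1.2 1 • v.1.1 • deriv n₂ x.1.1)) + v.2 • tubeFun k n₁ n₂ x.1 := by
  -- derivatives of the ingredients at `x`
  have h1 : HasFDerivAt (fun y : (ℝ × 𝔼 2) × ℝ => y.1) (ContinuousLinearMap.fst ℝ (ℝ × 𝔼 2) ℝ) x :=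
    hasFDerivAt_fst
  have ht : HasFDerivAt (fun y : (ℝ × 𝔼 2) × ℝ => y.1.1)
      ((ContinuousLinearMap.fst ℝ ℝ (𝔼 2)).comp (ContinuousLinearMap.fst ℝ (ℝ × 𝔼 2) ℝ)) x :=
    h1.fst
  have h12 : HasFDerivAt (fun y : (ℝ × 𝔼 2) × ℝ => y.1.2)
      ((ContinuousLinearMap.snd ℝ ℝ (𝔼 2)).comp (ContinuousLinearMap.fst ℝ (ℝ × 𝔼 2) ℝ)) x :=
    h1.snd
  have hs : HasFDerivAt (fun y : (ℝ × 𝔼 2) × ℝ => y.2) (ContinuousLinearMap.snd ℝ (ℝ × 𝔼 2) ℝ) x :=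
    hasFDerivAt_snd
  have hu : ∀ i : Fin 2, HasFDerivAt (fun y : (ℝ × 𝔼 2) × ℝ => y.1.2 i)
      ((PiLp.proj 2 (fun _ : Fin 2 => ℝ) i).comp ((ContinuousLinearMap.snd ℝ ℝ (𝔼 2)).comp
        (ContinuousLinearMap.fst ℝ (ℝ × 𝔼 2) ℝ))) x := fun i => by
    have := (PiLp.hasFDerivAt_apply (𝕜 := ℝ) 2 x.1.2 i).comp x h12
    exact this
  have hcomp : ∀ {f : ℝ → 𝔼 4}, ContDiff ℝ ∞ f → HasFDerivAt (fun y : (ℝ × 𝔼 2) × ℝ => f y.1.1)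
      ((ContinuousLinearMap.smulRight (1 : ℝ →L[ℝ] ℝ) (deriv f x.1.1)).comp
        ((ContinuousLinearMap.fst ℝ ℝ (𝔼 2)).comp (ContinuousLinearMap.fst ℝ (ℝ × 𝔼 2) ℝ))) x := by
    intro f hf
    have hd : HasDerivAt f (deriv f x.1.1) x.1.1 :=
      ((hf.differentiable (by simp)) _).hasDerivAt
    exact hd.hasFDerivAt.comp x ht
  have hG : HasFDerivAt (fun y : (ℝ × 𝔼 2) × ℝ => tubeFun k n₁ n₂ y.1) _ x :=
    ((hcomp hk).add ((hu 0).smul (hcomp hn₁))).add ((hu 1).smul (hcomp hn₂))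
  refine ⟨_, hs.smul hG, fun v => ?_⟩
  simp only [add_apply, smul_apply,
    ContinuousLinearMap.smulRight_apply, ContinuousLinearMap.comp_apply,
    ContinuousLinearMap.coe_fst', ContinuousLinearMap.coe_snd', one_apply_eq_self,
    PiLp.proj_apply, tubeFun_apply]
  abel

/-! #### Framed curves -/

/-- A **framed regular closed curve on `S³`**: a `C^∞` curve `k : ℝ → ℝ⁴` of period `1` on the
unit sphere with nowhere-vanishing velocity, together with two `C^∞` `1`-periodic normal fields
`n₁`, `n₂` such that `k, k', n₁, n₂` are pairwise orthogonal and nonzero (a trivialisation of the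
normal bundle of the curve in `S³`). [folklore] -/
structure IsFramedCurve (k n₁ n₂ : ℝ → 𝔼 4) : Prop where
  /-- The curve is `C^∞`. -/
  contDiff : ContDiff ℝ ∞ k
  /-- The first normal field is `C^∞`. -/
  contDiff₁ : ContDiff ℝ ∞ n₁
  /-- The second normal field is `C^∞`. -/
  contDiff₂ : ContDiff ℝ ∞ n₂
  /-- The curve has period `1`. -/
  periodic : Periodic k 1
  /-- The first normal field has period `1`. -/
  periodic₁ : Periodic n₁ 1
  /-- The second normal field has period `1`. -/
  periodic₂ : Periodic n₂ 1
  /-- The curve lies on the unit sphere. -/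
  norm_eq : ∀ t, ‖k t‖ = 1
  /-- The curve is regular. -/
  deriv_ne : ∀ t, deriv k t ≠ 0
  /-- The first normal field vanishes nowhere. -/
  ne₁ : ∀ t, n₁ t ≠ 0
  /-- The second normal field vanishes nowhere. -/
  ne₂ : ∀ t, n₂ t ≠ 0
  /-- The first normal field is tangent to the sphere. -/
  inner₁ : ∀ t, ⟪n₁ t, k t⟫ = 0
  /-- The second normal field is tangent to the sphere. -/
  inner₂ : ∀ t, ⟪n₂ t, k t⟫ = 0
  /-- The first normal field is normal to the curve. -/
  inner₁' : ∀ t, ⟪n₁ t, deriv k t⟫ = 0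
  /-- The second normal field is normal to the curve. -/
  inner₂' : ∀ t, ⟪n₂ t, deriv k t⟫ = 0
  /-- The two normal fields are orthogonal. -/
  inner₁₂ : ∀ t, ⟪n₁ t, n₂ t⟫ = 0

namespace IsFramedCurve

variable (h : IsFramedCurve k n₁ n₂)
include h

/-- The velocity of a curve on the unit sphere is tangent to the sphere. [folklore] -/
theorem inner_deriv (t : ℝ) : ⟪deriv k t, k t⟫ = 0 := by
  have hd : HasDerivAt k (deriv k t) t :=
    (h.contDiff.differentiable (by simp)).differentiableAt.hasDerivAt
  have h' := hd.inner ℝ hd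
  have hconst : (fun s => ⟪k s, k s⟫) = fun _ => (1 : ℝ) := by
    funext s
    rw [real_inner_self_eq_norm_sq, h.norm_eq, one_pow]
  rw [hconst] at h'
  have := h'.unique (hasDerivAt_const t (1 : ℝ))
  rw [real_inner_comm (k t)] at this
  rw [real_inner_comm]
  linarith

/-- The affine tube map is `1`-periodic in the curve parameter. [folklore] -/
theorem tubeFun_add_int (t : ℝ) (m : ℤ) (u : 𝔼 2) :
    tubeFun k n₁ n₂ (t + m, u) = tubeFun k n₁ n₂ (t, u) := by
  have h0 := (h.periodic.int_mul m) t
  have h1 := (h.periodic₁.int_mul m) t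
  have h2 := (h.periodic₂.int_mul m) t
  simp only [mul_one] at h0 h1 h2
  simp only [tubeFun_apply, h0, h1, h2]

/-- The radial tube map is `1`-periodic in the curve parameter. [folklore] -/
theorem tubeProj_add_int (t : ℝ) (m : ℤ) (u : 𝔼 2) :
    tubeProj k n₁ n₂ (t + m, u) = tubeProj k n₁ n₂ (t, u) := by
  simp only [tubeProj_apply, h.tubeFun_add_int]

/-- The cone map is `1`-periodic in the curve parameter. [folklore] -/
theorem tubeConeMap_add (x : (ℝ × 𝔼 2) × ℝ) :
    tubeConeMap k n₁ n₂ (x + ((1, 0), 0)) = tubeConeMap k n₁ n₂ x := by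
  obtain ⟨⟨t, u⟩, s⟩ := x
  have := h.tubeFun_add_int t 1 u
  simp only [Int.cast_one] at this
  simp [tubeConeMap_apply, this]

/-- On the core circle the radial tube map is the curve. [folklore] -/
theorem tubeProj_zero (t : ℝ) : tubeProj k n₁ n₂ (t, 0) = k t := by
  rw [tubeProj_apply, tubeFun_zero, h.norm_eq, inv_one, one_smul]

/-- **The cone map is a local diffeomorphism along the core circle**: its derivative at
`((t, 0), 1)` is `((τ, w), σ) ↦ τ k'(t) + w₀ n₁(t) + w₁ n₂(t) + σ k(t)`, an isomorphism since the
four vectors are pairwise orthogonal and nonzero. [folklore] -/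
theorem exists_hasFDerivAt_equiv (t : ℝ) :
    ∃ L : ((ℝ × 𝔼 2) × ℝ) ≃L[ℝ] 𝔼 4,
      HasFDerivAt (tubeConeMap k n₁ n₂) (L : ((ℝ × 𝔼 2) × ℝ) →L[ℝ] 𝔼 4) ((t, 0), 1) := by
  obtain ⟨L, hL, hLv⟩ := hasFDerivAt_tubeConeMap h.contDiff h.contDiff₁ h.contDiff₂ ((t, 0), 1)
  have hLv' : ∀ v : (ℝ × 𝔼 2) × ℝ,
      L v = v.1.1 • deriv k t + v.1.2 0 • n₁ t + v.1.2 1 • n₂ t + v.2 • k t := by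
    intro v
    rw [hLv v]
    simp
  -- injectivity by taking inner products with the four orthogonal vectors
  have hinj : Injective L := by
    intro v w hvw
    rw [← sub_eq_zero]
    set d := v - w with hd_def
    have hd : d.1.1 • deriv k t + d.1.2 0 • n₁ t + d.1.2 1 • n₂ t + d.2 • k t = 0 := by
      rw [← hLv' d, hd_def, map_sub, hvw, sub_self]
    have e2 : d.2 = 0 := by
      have := congrArg (fun y => ⟪y, k t⟫) hd
      simp only [inner_add_left, real_inner_smul_left, h.inner_deriv, h.inner₁, h.inner₂,
        real_inner_self_eq_norm_sq, h.norm_eq, inner_zero_left] at this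
      simpa using this
    have e11 : d.1.1 = 0 := by
      have := congrArg (fun y => ⟪y, deriv k t⟫) hd
      simp only [inner_add_left, real_inner_smul_left, h.inner₁', h.inner₂',
        real_inner_comm (deriv k t) (k t), h.inner_deriv, inner_zero_left] at this
      simpa [h.deriv_ne t] using this
    have e120 : d.1.2 0 = 0 := by
      have := congrArg (fun y => ⟪y, n₁ t⟫) hd
      simp only [inner_add_left, real_inner_smul_left, real_inner_comm (n₁ t) (deriv k t),
        real_inner_comm (n₁ t) (k t), real_inner_comm (n₁ t) (n₂ t), h.inner₁', h.inner₁,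
        h.inner₁₂, inner_zero_left] at this
      simpa [h.ne₁ t] using this
    have e121 : d.1.2 1 = 0 := by
      have := congrArg (fun y => ⟪y, n₂ t⟫) hd
      simp only [inner_add_left, real_inner_smul_left, real_inner_comm (n₂ t) (deriv k t),
        real_inner_comm (n₂ t) (k t), h.inner₂', h.inner₂, h.inner₁₂, inner_zero_left] at this
      simpa [h.ne₂ t] using this
    refine Prod.ext (Prod.ext e11 ?_) e2
    ext i
    fin_cases i
    · simpa using e120
    · simpa using e121
  have hdim : Module.finrank ℝ ((ℝ × 𝔼 2) × ℝ) = Module.finrank ℝ (𝔼 4) := by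
    simp [Module.finrank_prod]
  set e := (LinearMap.linearEquivOfInjective (L : ((ℝ × 𝔼 2) × ℝ) →ₗ[ℝ] 𝔼 4) hinj
    hdim).toContinuousLinearEquiv with he_def
  have he : (e : ((ℝ × 𝔼 2) × ℝ) →L[ℝ] 𝔼 4) = L := ContinuousLinearMap.ext fun v => rfl
  exact ⟨e, he ▸ hL⟩

end IsFramedCurve

/-- The **good set** of a framed curve: the parameters `q = (t, u)` at which the affine tube map
does not vanish and the cone map has an invertible derivative at height `‖k + u₀n₁ + u₁n₂‖⁻¹`, so
that near `q` the radial tube map is a local homeomorphism onto an open subset of the sphere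
(inverse function theorem). [folklore] -/
def tubeGood (k n₁ n₂ : ℝ → 𝔼 4) : Set (ℝ × 𝔼 2) :=
  {q | tubeFun k n₁ n₂ q ≠ 0 ∧ fderiv ℝ (tubeConeMap k n₁ n₂) (q, ‖tubeFun k n₁ n₂ q‖⁻¹) ∈
    range ((↑) : (((ℝ × 𝔼 2) × ℝ) ≃L[ℝ] 𝔼 4) → ((ℝ × 𝔼 2) × ℝ) →L[ℝ] 𝔼 4)}

namespace IsFramedCurve

variable (h : IsFramedCurve k n₁ n₂)
include h

/-- The good set is open (the derivative is continuous and invertibility is an open condition,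
`ContinuousLinearEquiv.isOpen`). [folklore] -/
theorem isOpen_tubeGood : IsOpen (tubeGood k n₁ n₂) := by
  have hG := continuous_tubeFun h.contDiff h.contDiff₁ h.contDiff₂
  have hU : IsOpen {q : ℝ × 𝔼 2 | tubeFun k n₁ n₂ q ≠ 0} :=
    isOpen_compl_singleton.preimage hG
  have hF : Continuous (fderiv ℝ (tubeConeMap k n₁ n₂)) :=
    (contDiff_tubeConeMap h.contDiff h.contDiff₁ h.contDiff₂).continuous_fderiv (by simp)
  have hΘ : ContinuousOn (fun q : ℝ × 𝔼 2 => (q, ‖tubeFun k n₁ n₂ q‖⁻¹))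
      {q | tubeFun k n₁ n₂ q ≠ 0} :=
    continuousOn_id.prodMk (hG.continuousOn.norm.inv₀ fun q hq => norm_ne_zero_iff.2 hq)
  exact (hF.comp_continuousOn hΘ).isOpen_inter_preimage hU ContinuousLinearEquiv.isOpen

/-- The core circle lies in the good set. [folklore] -/
theorem mk_zero_mem_tubeGood (t : ℝ) : ((t, 0) : ℝ × 𝔼 2) ∈ tubeGood k n₁ n₂ := by
  have hk0 : k t ≠ 0 := fun h0 => by simpa [h0] using h.norm_eq t
  refine ⟨by rwa [tubeFun_zero], ?_⟩
  obtain ⟨L, hL⟩ := h.exists_hasFDerivAt_equiv t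
  rw [tubeFun_zero, h.norm_eq, inv_one, hL.fderiv]
  exact mem_range_self L

/-- The good set is invariant under integer translation of the curve parameter. [folklore] -/
theorem mem_tubeGood_add_int_iff (t : ℝ) (m : ℤ) (u : 𝔼 2) :
    ((t + m, u) : ℝ × 𝔼 2) ∈ tubeGood k n₁ n₂ ↔ ((t, u) : ℝ × 𝔼 2) ∈ tubeGood k n₁ n₂ := by
  have hper : ∀ x : (ℝ × 𝔼 2) × ℝ,
      fderiv ℝ (tubeConeMap k n₁ n₂) (x + ((1, 0), 0)) = fderiv ℝ (tubeConeMap k n₁ n₂) x := by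
    intro x
    rw [← fderiv_comp_add_right]
    congr 1
    funext y
    exact h.tubeConeMap_add y
  have hperP : Periodic (fun s : ℝ => (((s, u) : ℝ × 𝔼 2) ∈ tubeGood k n₁ n₂)) 1 := by
    intro s
    simp only [tubeGood, mem_setOf_eq]
    have h1 := h.tubeFun_add_int s 1 u
    simp only [Int.cast_one] at h1
    have h2 := hper ((s, u), ‖tubeFun k n₁ n₂ (s, u)‖⁻¹)
    simp only [Prod.mk_add_mk, add_zero] at h2
    rw [h1, h2]
  have := (hperP.int_mul m) t
  simp only [mul_one, eq_iff_iff] at this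
  exact this

/-- **A uniform tube radius**: for some `ε > 0` the whole slab `ℝ × B(0, ε)` lies in the good set
(the good set is open, contains the core circle, and is `1`-periodic; compactness of `[0, 1]`,
`generalized_tube_lemma`). [folklore] -/
theorem exists_ball_subset_tubeGood :
    ∃ ε > 0, ∀ (t : ℝ), ∀ u ∈ ball (0 : 𝔼 2) ε, ((t, u) : ℝ × 𝔼 2) ∈ tubeGood k n₁ n₂ := by
  obtain ⟨U, V, -, hV, hsU, htV, hUV⟩ := generalized_tube_lemma (isCompact_Icc (a := (0 : ℝ))
    (b := 1)) (isCompact_singleton (x := (0 : 𝔼 2))) h.isOpen_tubeGood (by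
      rintro ⟨a, b⟩ ⟨-, hb⟩
      rw [mem_singleton_iff] at hb
      subst hb
      exact h.mk_zero_mem_tubeGood a)
  obtain ⟨ε, hε, hεV⟩ := Metric.isOpen_iff.1 hV 0 (htV rfl)
  refine ⟨ε, hε, fun t u hu => ?_⟩
  have h1 : ((Int.fract t, u) : ℝ × 𝔼 2) ∈ tubeGood k n₁ n₂ :=
    hUV ⟨hsU ⟨Int.fract_nonneg t, (Int.fract_lt_one t).le⟩, hεV hu⟩
  have h2 := (h.mem_tubeGood_add_int_iff (Int.fract t) ⌊t⌋ u).2 h1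
  rwa [Int.fract_add_floor] at h2

/-- At a good parameter the cone map has an invertible strict derivative at height
`‖k + u₀n₁ + u₁n₂‖⁻¹`. [folklore] -/
theorem exists_hasStrictFDerivAt {q : ℝ × 𝔼 2} (hq : q ∈ tubeGood k n₁ n₂) :
    ∃ e : ((ℝ × 𝔼 2) × ℝ) ≃L[ℝ] 𝔼 4, HasStrictFDerivAt (tubeConeMap k n₁ n₂)
      (e : ((ℝ × 𝔼 2) × ℝ) →L[ℝ] 𝔼 4) (q, ‖tubeFun k n₁ n₂ q‖⁻¹) := by
  obtain ⟨-, e, he⟩ := hq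
  refine ⟨e, ?_⟩
  have := (contDiff_tubeConeMap h.contDiff h.contDiff₁ h.contDiff₂).contDiffAt.hasStrictFDerivAt
    (x := (q, ‖tubeFun k n₁ n₂ q‖⁻¹)) (by simp)
  rwa [← he] at this

/-- **The radial tube map is open into the sphere at good parameters**: the image of every
neighbourhood of `q` contains a neighbourhood of the image point intersected with the unit sphere
(inverse function theorem for the cone map, `HasStrictFDerivAt.map_nhds_eq_of_equiv`).
[folklore] -/
theorem exists_nhds_inter_sphere_subset_image {q : ℝ × 𝔼 2} (hq : q ∈ tubeGood k n₁ n₂)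
    {N : Set (ℝ × 𝔼 2)} (hN : N ∈ 𝓝 q) :
    ∃ V ∈ 𝓝 (tubeProj k n₁ n₂ q), V ∩ sphere (0 : 𝔼 4) 1 ⊆ tubeProj k n₁ n₂ '' N := by
  have hq0 : tubeFun k n₁ n₂ q ≠ 0 := hq.1
  obtain ⟨e, he⟩ := h.exists_hasStrictFDerivAt hq
  have hs : (0 : ℝ) < ‖tubeFun k n₁ n₂ q‖⁻¹ := inv_pos.2 (norm_pos_iff.2 hq0)
  refine ⟨tubeConeMap k n₁ n₂ '' (N ×ˢ Ioi (0 : ℝ)), ?_, ?_⟩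
  · rw [← tubeConeMap_inv_norm, ← he.map_nhds_eq_of_equiv]
    exact image_mem_map (prod_mem_nhds hN (Ioi_mem_nhds hs))
  · rintro y ⟨⟨⟨q', s⟩, ⟨hq', hs'⟩, rfl⟩, hy⟩
    rw [mem_Ioi] at hs'
    rw [mem_sphere_zero_iff_norm, tubeConeMap_apply, norm_smul, Real.norm_of_nonneg hs'.le] at hy
    refine ⟨q', hq', ?_⟩
    have hq'0 : ‖tubeFun k n₁ n₂ q'‖ ≠ 0 := fun h0 => by simp [h0] at hy
    rw [tubeProj_apply, tubeConeMap_apply]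
    congr 1
    field_simp
    linarith

/-- **The radial tube map is locally injective at good parameters** (inverse function theorem for
the cone map: `tubeProj q = tubeConeMap (q, ‖G q‖⁻¹)` and the cone map is injective near
`(q, ‖G q‖⁻¹)`). [folklore] -/
theorem exists_injOn_tubeProj {q : ℝ × 𝔼 2} (hq : q ∈ tubeGood k n₁ n₂) :
    ∃ W ∈ 𝓝 q, InjOn (tubeProj k n₁ n₂) W := by
  have hq0 : tubeFun k n₁ n₂ q ≠ 0 := hq.1
  obtain ⟨e, he⟩ := h.exists_hasStrictFDerivAt hq
  set Φ := he.toOpenPartialHomeomorph _ with hΦ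
  have hΘ : ContinuousAt (fun q' : ℝ × 𝔼 2 => (q', ‖tubeFun k n₁ n₂ q'‖⁻¹)) q := by
    have hc := (continuous_tubeFun h.contDiff h.contDiff₁ h.contDiff₂).continuousAt (x := q)
    exact continuousAt_id.prodMk (hc.norm.inv₀ (norm_ne_zero_iff.2 hq0))
  refine ⟨(fun q' : ℝ × 𝔼 2 => (q', ‖tubeFun k n₁ n₂ q'‖⁻¹)) ⁻¹' Φ.source,
    hΘ.preimage_mem_nhds (Φ.open_source.mem_nhds he.mem_toOpenPartialHomeomorph_source), ?_⟩
  intro q₁ hq₁ q₂ hq₂ heq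
  have : tubeConeMap k n₁ n₂ (q₁, ‖tubeFun k n₁ n₂ q₁‖⁻¹) =
      tubeConeMap k n₁ n₂ (q₂, ‖tubeFun k n₁ n₂ q₂‖⁻¹) := by
    rw [tubeConeMap_inv_norm, tubeConeMap_inv_norm]; exact heq
  have hinj := Φ.injOn hq₁ hq₂
  rw [hΦ, HasStrictFDerivAt.toOpenPartialHomeomorph_coe] at hinj
  exact congrArg Prod.fst (hinj this)

end IsFramedCurve

/-! #### Tube radii and the descended tube map -/

/-- Local notation: `𝕊 n` is the unit sphere in `EuclideanSpace ℝ (Fin (n + 1))`. -/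
local notation "𝕊 " n:arg => (Metric.sphere (0 : EuclideanSpace ℝ (Fin (n + 1))) 1)

/-- A **tube radius** for a framed curve `(k, n₁, n₂)`: a radius `ε > 0` such that the slab
`ℝ × B(0, ε)` consists of good parameters (`tubeGood`: the radial tube map is open into the sphere
and locally injective there) and on it the radial tube map `tubeProj` identifies two parameters
`(t₁, u₁)`, `(t₂, u₂)` only if `t₁ - t₂ ∈ ℤ` and `u₁ = u₂`; i.e. `tubeProj` descends to a
topological embedding `ℝ/ℤ × B(0, ε) ↪ S³`. Such radii exist for every framed curve that is
injective modulo `ℤ` (`IsFramedCurve.exists_isTubeRadius`, `KnotTubeProofs.lean`). [folklore] -/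
structure IsTubeRadius (k n₁ n₂ : ℝ → 𝔼 4) (ε : ℝ) : Prop where
  /-- The radius is positive. -/
  pos : 0 < ε
  /-- The slab `ℝ × B(0, ε)` consists of good parameters. -/
  mem_tubeGood : ∀ (t : ℝ), ∀ u ∈ ball (0 : 𝔼 2) ε, ((t, u) : ℝ × 𝔼 2) ∈ tubeGood k n₁ n₂
  /-- On the slab, the radial tube map identifies exactly the `ℤ`-translates in the curve
  parameter. -/
  eq_of_tubeProj_eq : ∀ (t₁ t₂ : ℝ) (u₁ u₂ : 𝔼 2), u₁ ∈ ball (0 : 𝔼 2) ε → u₂ ∈ ball (0 : 𝔼 2) ε →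
    tubeProj k n₁ n₂ (t₁, u₁) = tubeProj k n₁ n₂ (t₂, u₂) → (∃ m : ℤ, t₁ = t₂ + m) ∧ u₁ = u₂

/-- The **descended tube map** `S¹ × ℝ² → ℝ⁴` of a framed curve with radius `ε`:
`(z, u) ↦ tubeProj (angA z, univBall 0 ε u)`, where `angA : S¹ → (0, 1]` is a (discontinuous)
section of the covering `circlePt : ℝ → S¹` (`TorusCoordinates.lean`; by `ℤ`-periodicity of
`tubeProj` the choice of section is immaterial) and `univBall 0 ε : ℝ² ≅ B(0, ε)` is Mathlib's
homeomorphism onto the ball (for `ε ≤ 0` Mathlib lets `univBall 0 ε` be the identity; only tube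
radii `ε > 0` are ever used). For a tube radius `ε` of an embedded framed curve this is a
continuous, injective, open map onto an open subset of `S³` with `tubeMap (z, 0) = k (angA z)`
(`KnotTubeProofs.lean`). [folklore] -/
def tubeMap (k n₁ n₂ : ℝ → 𝔼 4) (ε : ℝ) (x : (𝕊 1) × 𝔼 2) : 𝔼 4 :=
  tubeProj k n₁ n₂ (angA x.1, OpenPartialHomeomorph.univBall (0 : 𝔼 2) ε x.2)

/-- Unfolding of the descended tube map. [folklore] -/
theorem tubeMap_apply (k n₁ n₂ : ℝ → 𝔼 4) (ε : ℝ) (x : (𝕊 1) × 𝔼 2) :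
    tubeMap k n₁ n₂ ε x =
      tubeProj k n₁ n₂ (angA x.1, OpenPartialHomeomorph.univBall (0 : 𝔼 2) ε x.2) :=
  rfl

/-- On the zero section the descended tube map is the curve: `tubeMap (z, 0) = k (angA z)`
(for a framed curve, `‖k‖ = 1`). [folklore] -/
theorem IsFramedCurve.tubeMap_zero {k n₁ n₂ : ℝ → 𝔼 4} (h : IsFramedCurve k n₁ n₂) (ε : ℝ)
    (z : 𝕊 1) : tubeMap k n₁ n₂ ε (z, 0) = k (angA z) := by
  rw [tubeMap_apply, OpenPartialHomeomorph.univBall_apply_zero, h.tubeProj_zero]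

end Tube

end Literature.Topology.FourManifolds
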